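import Literature.AlgebraicGeometry.Resolution.MarkedIdealsLemmas
import Literature.AlgebraicGeometry.Resolution.PermissibleCentres
import HarnessLib

/-!
# [OURS · L1 W4.5(b) · EL♮(3)] Rung TOWER₀, (pt-ram) supplier — «`supp J = {y}` ⇒ `J_y` is `𝔪`-primary» (the last downstairs→upstairs input of
# `exists_multisection_comap_eq[_of_model]`; crux `EquisingularLiftNatThree` = stmt-ResolutionOfSingularities-20148 / stmt-…-20038)

HONEST FRAMING. OURS (cell res-hironaka, crux chain w45b, slot W4.5(b)); NOT a statement of any manuscript; AI-written, weaker than expert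
review. Helper `--supports stmt-ResolutionOfSingularities-20148 --as helper`; closes nothing. `TowerPtRam` (…NatTowerDefs p541504) prescribes the
centre downstairs by `(J.support : Set G) = {y}` + stalk generators; the supplier (…NatCurvilinearMultisection p547075, `hprim`) wants
`∃ N, 𝔪_y ^ N ≤ J_y`. This file is that bridge on any locally Noetherian scheme: every prime of `𝒪_{X,y}` over `J_y` is the point of a
generization `z` of `y` with `z ∈ supp J` (tree `exists_isLocalizationAtPrime_stalk`, `mem_support_iff_stalkIdeal_le`), so `z = y`, so the prime
is `𝔪_y` (a localization of `𝒪_y` at a SMALLER prime would invert an element of `𝔪_y`, but `𝔪_y = 𝓘{y}_y` is carried to `𝔪` by the same map);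
hence `√J_y = 𝔪_y` and a power of `𝔪_y` lies in `J_y` (Noetherian). Pure stalk algebra.
-/

set_option linter.dupNamespace false -- mandated namespace `Summit.<Summit>.<Problem>` of this single-conjunct summit

noncomputable section

universe u

open CategoryTheory AlgebraicGeometry TopologicalSpace IsLocalRing
open Literature.AlgebraicGeometry.Resolution

namespace Summit.ResolutionOfSingularities.ResolutionOfSingularities.Cruxes.EquisingularLiftNat.Sections

/-- **An ideal sheaf supported at one closed point has `𝔪`-primary stalk there**: `supp J = {y}` ⇒ `∃ N, 𝔪_y ^ N ≤ J_y`.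
[folklore; stalk algebra over the tree's generization lemma] -/
theorem exists_pow_maximalIdeal_le_stalkIdeal_of_support_eq {X : Scheme.{u}} [IsLocallyNoetherian X] (J : X.IdealSheafData)
    {y : X} (hy : IsClosed ({y} : Set X)) (hsupp : (J.support : Set X) = {y}) :
    ∃ N : ℕ, maximalIdeal (X.presheaf.stalk y) ^ N ≤ stalkIdeal J y := by
  -- every prime over `J_y` contains (hence equals) `𝔪_y`
  have key : ∀ (P : Ideal (X.presheaf.stalk y)) [P.IsPrime], stalkIdeal J y ≤ P →
      maximalIdeal (X.presheaf.stalk y) ≤ P := by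
    intro P _ hP
    obtain ⟨z, φ, hloc, hst⟩ := exists_isLocalizationAtPrime_stalk y P
    letI := φ.toAlgebra
    haveI := hloc
    have hφ : ∀ a, algebraMap (X.presheaf.stalk y) (X.presheaf.stalk z) a = φ a := fun _ => rfl
    -- the generization `z` lies in `supp J`: `J_z = J_y · 𝒪_z ⊆ P · 𝒪_z ⊆ 𝔪_z`
    have hz : z ∈ J.support := by
      rw [mem_support_iff_stalkIdeal_le, hst J, Ideal.map_le_iff_le_comap]
      intro a ha
      rw [Ideal.mem_comap, ← hφ]
      exact (IsLocalization.AtPrime.to_map_mem_maximal_iff (X.presheaf.stalk z) P a).mpr (hP ha)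
    have hzy : z = y := by
      have hz' : z ∈ (J.support : Set X) := hz
      rw [hsupp] at hz'
      exact hz'
    subst hzy
    -- `𝔪 · 𝒪 = 𝔪` along `φ` (the stalk of `𝓘{y}`), so no element of `𝔪` becomes a unit: `𝔪 ⊆ P`
    intro a ha
    by_contra haP
    have hunit : IsUnit (φ a) := by
      rw [← hφ]; exact IsLocalization.map_units (X.presheaf.stalk z) (⟨a, haP⟩ : P.primeCompl)
    have h𝔪 : (maximalIdeal (X.presheaf.stalk z)).map φ = maximalIdeal (X.presheaf.stalk z) := by
      have h := hst (Scheme.IdealSheafData.vanishingIdeal ⟨{z}, hy⟩)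
      rw [stalkIdeal_vanishingIdeal_singleton hy] at h
      exact h.symm
    have hmem : φ a ∈ maximalIdeal (X.presheaf.stalk z) := h𝔪 ▸ Ideal.mem_map_of_mem φ ha
    exact ((IsLocalRing.mem_maximalIdeal _).mp hmem) hunit
  have hrad : maximalIdeal (X.presheaf.stalk y) ≤ (stalkIdeal J y).radical := by
    rw [Ideal.radical_eq_sInf]
    exact le_sInf fun P hP => by haveI := hP.2; exact key P hP.1
  exact Ideal.exists_pow_le_of_le_radical_of_fg hrad (IsNoetherian.noetherian _)

end Summit.ResolutionOfSingularities.ResolutionOfSingularities.Cruxes.EquisingularLiftNat.Sections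

end
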